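import Literature.Probability.Percolation.LatticeCycleSpace
import Literature.Probability.LatticeModels.StarCrossing
import HarnessLib

/-!
# Boundary connectivity in `ℤ²` via graph theory (Timár): the `∗`-boundary of a `∗`-cluster

Topic `Probability/Percolation`. Á. Timár, *Boundary-connectivity via graph theory*, Proc. AMS 141
(2013): if the cycle space of a graph is generated by "small" cycles, then the outer boundary of a
connected set, seen from one complementary component, is connected in a suitable sense. We
formalise the argument (§2, proof of Lemma 2 / Thm. 3) and apply it to the `∗`-graph (king's graph)
of `ℤ²`, whose even edge sets are generated by the triangles and unit squares
(`exists_eq_xorSum_kingBasic`, from `exists_eq_xorSum_unitSq`):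

* `reachable_of_oddDeg_iff` — an edge set whose odd vertices are exactly `x ≠ y` joins `x` to
  `y` (Euler's peeling argument);
* `exists_walk_boundary_of_xorSum` — **Timár's lemma**, abstract form: if `P₁` joins `x` to `y`
  avoiding `C`, `P₂` joins them with every edge touching `C`, and `P₁ + P₂` is a mod-2 sum of basic
  even cycles each of which, when it meets `C`, has all its other vertices in `B`, then `x` and
  `y` are joined by a walk through `B ∖ C`;
* **`exists_starWalk_starBoundary`** — for a finite `∗`-connected `C ⊆ ℤ²` and sites `x, y ∉ C`
  that are `∗`-adjacent to `C` and joined by a `∗`-walk avoiding `C`, there is a `∗`-walk from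
  `x` to `y` all of whose sites are `∗`-adjacent to `C` and outside `C` (Kesten 1982, Lemma 2.23
  type statement; the input of the "onion" argument in Georgii–Higuchi 2000, proof of Lemma 2.3:
  "its outer boundary belongs to a `-∗`cluster").

## References

* Á. Timár, Proc. Amer. Math. Soc. 141 (2013) 475–480 [Timar2013].
* H. Kesten, *Percolation theory for mathematicians*, Birkhäuser 1982, §2.2, Lemma 2.23 [Kesten1982].
* H.-O. Georgii, Y. Higuchi, J. Math. Phys. 41 (2000), proof of Lemma 2.3 [GeorgiiHiguchi2000].
-/

noncomputable section

open SimpleGraph Finset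
open scoped symmDiff
open Literature.Probability.LatticeModels (Site zdGraph zdStarGraph zdGraph_adj_iff zdStarGraph_adj
  zdGraph_le_zdStarGraph)

namespace Literature.Probability.Percolation

/-! ### Euler's peeling argument -/

section Euler

variable {V : Type*} [DecidableEq V]

/-- Removing one edge changes the parity of exactly its two endpoints. [folklore] -/
theorem oddDeg_erase_iff {E : Finset (Sym2 V)} {e : Sym2 V} (he : e ∈ E) (v : V) :
    OddDeg (E.erase e) v ↔ (OddDeg E v ↔ v ∉ e) := by
  have hE : E = ({e} : Finset (Sym2 V)) ∆ E.erase e := by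
    ext e'
    rw [Finset.mem_symmDiff, Finset.mem_singleton, Finset.mem_erase]
    by_cases h : e' = e
    · subst h; simp [he]
    · simp [h]
  induction e using Sym2.ind with
  | h a b =>
    conv_rhs => rw [hE, oddDeg_symmDiff_iff, oddDeg_singleton_iff]
    rw [Sym2.mem_iff]
    tauto

/-- An odd vertex has an edge. [folklore] -/
theorem exists_mem_of_oddDeg {E : Finset (Sym2 V)} {v : V} (h : OddDeg E v) : ∃ e ∈ E, v ∈ e := by
  by_contra hne
  push Not at hne
  have : E.filter (fun e => v ∈ e) = ∅ := Finset.filter_eq_empty_iff.2 fun e he hv => hne e he hv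
  rw [OddDeg, this] at h
  simp at h

/-- **Euler's peeling argument**: if the odd vertices of a finite set `E` of edges of `G` are exactly
`x` and `y ≠ x`, then `x` and `y` are joined by a `G`-walk of positive length using only edges of
`E`. [folklore] -/
theorem exists_walk_of_oddDeg_iff {G : SimpleGraph V} :
    ∀ (n : ℕ) (E : Finset (Sym2 V)), #E ≤ n → (∀ e ∈ E, e ∈ G.edgeSet) →
      ∀ (x y : V), x ≠ y → (∀ v, OddDeg E v ↔ (v = x ∨ v = y)) →
        ∃ p : G.Walk x y, 0 < p.length ∧ ∀ e ∈ p.edges, e ∈ E := by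
  intro n
  induction n with
  | zero =>
    intro E hE _ x y _ hodd
    have hx : OddDeg E x := (hodd x).2 (Or.inl rfl)
    obtain ⟨e, he, -⟩ := exists_mem_of_oddDeg hx
    have : #E = 0 := Nat.le_zero.1 hE
    rw [Finset.card_eq_zero] at this
    rw [this] at he; simp at he
  | succ n ih =>
    intro E hE hEG x y hxy hodd
    have hx : OddDeg E x := (hodd x).2 (Or.inl rfl)
    obtain ⟨e, he, hxe⟩ := exists_mem_of_oddDeg hx
    -- `e = s(x, z)`
    obtain ⟨z, rfl⟩ : ∃ z, e = s(x, z) := by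
      induction e using Sym2.ind with
      | h a b =>
        rcases Sym2.mem_iff.1 hxe with rfl | rfl
        · exact ⟨b, rfl⟩
        · exact ⟨a, Sym2.eq_swap⟩
    have hadj : G.Adj x z := by have := hEG _ he; simpa using this
    by_cases hzy : z = y
    · subst hzy
      exact ⟨Walk.cons hadj Walk.nil, by simp, fun e' he' => by
        simp only [Walk.edges_cons, Walk.edges_nil, List.mem_cons, List.not_mem_nil, or_false] at he'
        rw [he']; exact he⟩
    · -- peel the edge and recurse from `z`
      set E' := E.erase s(x, z) with hE'
      have hcard : #E' ≤ n := by
        rw [hE', Finset.card_erase_of_mem he]; omega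
      have hodd' : ∀ v, OddDeg E' v ↔ (v = z ∨ v = y) := by
        intro v
        rw [hE', oddDeg_erase_iff he, hodd v, Sym2.mem_iff]
        have hzx : z ≠ x := hadj.ne.symm
        by_cases hvx : v = x
        · subst hvx
          have h1 : ¬ v = z := fun h => hzx h.symm
          simp [h1, hxy]
        · by_cases hvz : v = z
          · subst hvz; simp [hvx, hzy]
          · simp [hvx, hvz]
      obtain ⟨q, -, hq⟩ := ih E' hcard (fun e' he' => hEG e' (Finset.mem_of_mem_erase he')) z y hzy hodd'
      exact ⟨Walk.cons hadj q, by simp, fun e' he' => by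
        rw [Walk.edges_cons, List.mem_cons] at he'
        rcases he' with rfl | he'
        · exact he
        · exact Finset.mem_of_mem_erase (hq e' he')⟩

end Euler

/-! ### Timár's lemma, abstract form -/

section Timar

variable {V : Type*} [DecidableEq V]

/-- Endpoints of edges of the mod-2 edge set of a walk lie on the walk. [folklore] -/
theorem mem_support_of_mem_edgeParity {G : SimpleGraph V} {a b : V} (p : G.Walk a b) {e : Sym2 V}
    (he : e ∈ p.edgeParity) {v : V} (hv : v ∈ e) : v ∈ p.support := by
  have h := mem_edges_of_mem_edgeParity p he
  induction e using Sym2.ind with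
  | h s t =>
    rcases Sym2.mem_iff.1 hv with rfl | rfl
    · exact Walk.fst_mem_support_of_mem_edges _ h
    · exact Walk.snd_mem_support_of_mem_edges _ h

/-- **Timár's lemma (abstract form)** (Timár 2013, proof of Lemma 2): let `P₁` join `x` to `y ≠ x`
avoiding `C`, let `P₂` join them with every edge touching `C`, and suppose the even set
`P₁ + P₂` is a mod-2 sum of even edge sets `f i`, `i ∈ S`, of `G` such that every `f i` meeting `C`
has all its vertices in `C ∪ B`. Then `x` and `y` are joined by a `G`-walk all of whose vertices lie
in `B` and outside `C`. Proof: with `𝒪₁ = {i : f i meets C}`, the set `F = P₂ + Σ_{𝒪₁} f i`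
equals `P₁ + Σ_{S ∖ 𝒪₁} f i`, so its edges avoid `C`; hence `F ⊆ Σ_{𝒪₁} f i` has its vertices in
`B`; its odd vertices are `x, y`; Euler. [cite: Timar2013, Lemma 2 (proof)] -/
theorem exists_walk_boundary_of_xorSum {G : SimpleGraph V} {C B : Set V} [DecidablePred (· ∈ C)]
    {x y : V} (hxy : x ≠ y) (P₁ : G.Walk x y) (hP₁ : ∀ v ∈ P₁.support, v ∉ C)
    (P₂ : G.Walk x y) (hP₂ : ∀ e ∈ P₂.edges, ∃ v ∈ e, v ∈ C)
    {ι : Type*} [DecidableEq ι] (f : ι → Finset (Sym2 V)) (S : Finset ι)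
    (hf : ∀ i ∈ S, IsEulerian (f i)) (hfG : ∀ i ∈ S, ∀ e ∈ f i, e ∈ G.edgeSet)
    (hsum : P₁.edgeParity ∆ P₂.edgeParity = xorSum f S)
    (hB : ∀ i ∈ S, (∃ e ∈ f i, ∃ v ∈ e, v ∈ C) → ∀ e ∈ f i, ∀ v ∈ e, v ∉ C → v ∈ B) :
    ∃ q : G.Walk x y, ∀ v ∈ q.support, v ∈ B ∧ v ∉ C := by
  classical
  set O₁ := S.filter fun i => ∃ e ∈ f i, ∃ v ∈ e.toFinset, v ∈ C with hO₁
  have hO₁S : O₁ ⊆ S := Finset.filter_subset _ _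
  have hmemO₁ : ∀ i, i ∈ O₁ ↔ i ∈ S ∧ ∃ e ∈ f i, ∃ v ∈ e, v ∈ C := by
    intro i; simp [hO₁, Sym2.mem_toFinset]
  set F := P₂.edgeParity ∆ xorSum f O₁ with hF
  -- `F = P₁ + Σ_{S \\ O₁}`
  have hF' : F = P₁.edgeParity ∆ xorSum f (S \ O₁) := by
    have h1 : P₂.edgeParity = P₁.edgeParity ∆ xorSum f S := by
      rw [← hsum, ← symmDiff_assoc, symmDiff_self, bot_symmDiff]
    have hSO : S ∆ O₁ = S \ O₁ := by
      ext i
      rw [Finset.mem_symmDiff, Finset.mem_sdiff]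
      constructor
      · rintro (⟨h1, h2⟩ | ⟨h1, h2⟩)
        · exact ⟨h1, h2⟩
        · exact absurd (hO₁S h1) h2
      · rintro ⟨h1, h2⟩; exact Or.inl ⟨h1, h2⟩
    rw [hF, h1, symmDiff_assoc, xorSum_symmDiff, hSO]
  -- edges of `F` avoid `C`
  have havoid : ∀ e ∈ F, ∀ v ∈ e, v ∉ C := by
    intro e he v hv hvC
    rw [hF'] at he
    rcases Finset.mem_symmDiff.1 he with ⟨h1, -⟩ | ⟨h1, -⟩
    · exact hP₁ v (mem_support_of_mem_edgeParity P₁ h1 hv) hvC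
    · obtain ⟨i, hi, hei⟩ := exists_mem_of_mem_xorSum h1
      rw [Finset.mem_sdiff] at hi
      exact hi.2 ((hmemO₁ i).2 ⟨hi.1, e, hei, v, hv, hvC⟩)
  -- hence `F ⊆ Σ_{O₁}` and its vertices are in `B`
  have hFsub : ∀ e ∈ F, ∃ i ∈ O₁, e ∈ f i := by
    intro e he
    have he' := he
    rw [hF] at he'
    rcases Finset.mem_symmDiff.1 he' with ⟨h1, -⟩ | ⟨h1, -⟩
    · exfalso
      obtain ⟨v, hv, hvC⟩ := hP₂ e (mem_edges_of_mem_edgeParity P₂ h1)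
      exact havoid e he v hv hvC
    · exact exists_mem_of_mem_xorSum h1
  have hFB : ∀ e ∈ F, ∀ v ∈ e, v ∈ B ∧ v ∉ C := by
    intro e he v hv
    obtain ⟨i, hi, hei⟩ := hFsub e he
    have hi' := (hmemO₁ i).1 hi
    exact ⟨hB i hi'.1 hi'.2 e hei v hv (havoid e he v hv), havoid e he v hv⟩
  have hFG : ∀ e ∈ F, e ∈ G.edgeSet := by
    intro e he
    obtain ⟨i, hi, hei⟩ := hFsub e he
    exact hfG i (hO₁S hi) e hei
  -- odd vertices of `F`
  have hodd : ∀ v, OddDeg F v ↔ (v = x ∨ v = y) := by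
    intro v
    rw [hF, oddDeg_symmDiff_iff, oddDeg_edgeParity_iff]
    have heu : ¬ OddDeg (xorSum f O₁) v := isEulerian_xorSum (fun i hi => hf i (hO₁S hi)) v
    simp [heu, hxy]
  obtain ⟨q, hqlen, hq⟩ := exists_walk_of_oddDeg_iff (G := G) #F F le_rfl hFG x y hxy hodd
  refine ⟨q, fun v hv => ?_⟩
  -- every vertex of a walk of positive length lies on one of its edges
  obtain ⟨e, he, hve⟩ : ∃ e ∈ q.edges, v ∈ e := by
    have key : ∀ {u w : V} (W : G.Walk u w), 0 < W.length → ∀ z ∈ W.support, ∃ e ∈ W.edges, z ∈ e := by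
      intro u w W
      induction W with
      | nil => intro h; simp at h
      | @cons u₁ u₂ u₃ hadj W' ih =>
        intro _ z hz
        rw [Walk.support_cons, List.mem_cons] at hz
        rcases hz with rfl | hz
        · exact ⟨s(z, u₂), by simp [Walk.edges_cons], Sym2.mem_mk_left _ _⟩
        · cases W' with
          | nil =>
            rw [Walk.support_nil, List.mem_singleton] at hz
            subst hz
            exact ⟨s(u₁, z), by simp [Walk.edges_cons], Sym2.mem_mk_right _ _⟩
          | cons h' W'' =>
            obtain ⟨e, he, hze⟩ := ih (by simp) z hz
            exact ⟨e, by rw [Walk.edges_cons]; exact List.mem_cons_of_mem _ he, hze⟩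
    exact key q hqlen v hv
  exact hFB e (hq e he) v hve

end Timar

/-! ### Triangles and squares generate the even edge sets of the `∗`-graph of `ℤ²` -/

section King

/-- The four corners of the unit square `u`, in cyclic order. [folklore] -/
def corner (u : Site 2) : Fin 4 → Site 2
  | 0 => u
  | 1 => u + ex
  | 2 => u + ex + ey
  | 3 => u + ey

/-- Corners of a unit square are `∗`-adjacent or equal. [folklore] -/
theorem corner_adj_or_eq (u : Site 2) (j k : Fin 4) : corner u j = corner u k ∨ zdStarGraph.Adj (corner u j) (corner u k) := by
  by_cases h : corner u j = corner u k
  · exact Or.inl h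
  · refine Or.inr ⟨h, fun i => ?_⟩
    fin_cases j <;> fin_cases k <;> fin_cases i <;> simp [corner]

/-- Distinct corner indices give distinct corners. [folklore] -/
theorem corner_injective (u : Site 2) : Function.Injective (corner u) := by
  intro j k h
  fin_cases j <;> fin_cases k <;> first | rfl | (exfalso; simp [corner, Site.eq_iff_two] at h)

/-- The **triangle** of the unit square `u` omitting the corner `k`: the closed `∗`-walk through the
other three corners. [cite: Timar2013, §2] -/
def triWalk (u : Site 2) (k : Fin 4) : zdStarGraph.Walk (corner u (k + 1)) (corner u (k + 1)) :=
  have h12 : zdStarGraph.Adj (corner u (k + 1)) (corner u (k + 2)) :=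
    (corner_adj_or_eq u _ _).resolve_left fun h => by have := corner_injective u h; omega
  have h23 : zdStarGraph.Adj (corner u (k + 2)) (corner u (k + 3)) :=
    (corner_adj_or_eq u _ _).resolve_left fun h => by have := corner_injective u h; omega
  have h31 : zdStarGraph.Adj (corner u (k + 3)) (corner u (k + 1)) :=
    (corner_adj_or_eq u _ _).resolve_left fun h => by have := corner_injective u h; omega
  Walk.cons h12 (Walk.cons h23 (Walk.cons h31 Walk.nil))

/-- The basic even edge sets of the `∗`-graph: the four triangles (`k < 4`) and the unit square
(`k = 4`) of each unit square `u`. [cite: Timar2013, §2] -/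
def kingBasic (p : Site 2 × Fin 5) : Finset (Sym2 (Site 2)) :=
  if h : (p.2 : ℕ) < 4 then (triWalk p.1 ⟨p.2, h⟩).edgeParity else unitSq p.1

/-- The basic sets are even. [cite: Timar2013, §2] -/
theorem isEulerian_kingBasic (p : Site 2 × Fin 5) : IsEulerian (kingBasic p) := by
  unfold kingBasic
  split_ifs with h
  · intro v hv; rw [oddDeg_edgeParity_iff] at hv; exact hv.1 rfl
  · exact isEulerian_unitSq _

/-- The basic sets consist of `∗`-edges. [folklore] -/
theorem kingBasic_subset_edgeSet (p : Site 2 × Fin 5) : ∀ e ∈ kingBasic p, e ∈ zdStarGraph.edgeSet := by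
  intro e he
  unfold kingBasic at he
  split_ifs at he with h
  · exact Walk.edges_subset_edgeSet _ (mem_edges_of_mem_edgeParity _ he)
  · exact edgeSet_mono zdGraph_le_zdStarGraph (unitSq_subset_edgeSet _ e he)

/-- Every vertex of an edge of a basic set of the square `u` is a corner of `u`. [folklore] -/
theorem corner_of_mem_kingBasic {p : Site 2 × Fin 5} {e : Sym2 (Site 2)} (he : e ∈ kingBasic p) {v : Site 2}
    (hv : v ∈ e) : ∃ j, v = corner p.1 j := by
  unfold kingBasic at he
  split_ifs at he with h
  · have h' := mem_edges_of_mem_edgeParity _ he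
    simp only [triWalk, Walk.edges_cons, Walk.edges_nil, List.mem_cons, List.not_mem_nil, or_false] at h'
    rcases h' with rfl | rfl | rfl <;> rcases Sym2.mem_iff.1 hv with rfl | rfl <;> exact ⟨_, rfl⟩
  · have hc := corner_of_mem_unitSq he hv
    have hv0 : v 0 = p.1 0 ∨ v 0 = p.1 0 + 1 := by have := hc 0; omega
    have hv1 : v 1 = p.1 1 ∨ v 1 = p.1 1 + 1 := by have := hc 1; omega
    rcases hv0 with h0 | h0 <;> rcases hv1 with h1 | h1
    · exact ⟨0, Site.eq_iff_two.2 ⟨by simp [corner, h0], by simp [corner, h1]⟩⟩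
    · exact ⟨3, Site.eq_iff_two.2 ⟨by simp [corner, h0], by simp [corner, h1]⟩⟩
    · exact ⟨1, Site.eq_iff_two.2 ⟨by simp [corner, h0], by simp [corner, h1]⟩⟩
    · exact ⟨2, Site.eq_iff_two.2 ⟨by simp [corner, h0], by simp [corner, h1]⟩⟩

/-- The diagonal `∗`-edges of the square `u`: for each, a triangle of `u` containing it whose other
two edges are lattice edges. [folklore] -/
theorem exists_tri_of_diag {a b : Site 2} (hab : zdStarGraph.Adj a b) (hnot : ¬ (zdGraph 2).Adj a b) :
    ∃ (u : Site 2) (k : Fin 4), s(a, b) ∈ (triWalk u k).edgeParity ∧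
      ∀ e ∈ (triWalk u k).edgeParity, e ≠ s(a, b) → e ∈ (zdGraph 2).edgeSet := by
  -- a triangle whose closing (third) edge is `s(c, d)` and whose first two edges are lattice edges
  have key : ∀ (u : Site 2) (k : Fin 4) (c d : Site 2), corner u (k + 3) = c → corner u (k + 1) = d →
      (zdGraph 2).Adj (corner u (k + 1)) (corner u (k + 2)) →
      (zdGraph 2).Adj (corner u (k + 2)) (corner u (k + 3)) →
      s(c, d) ∈ (triWalk u k).edgeParity ∧
        ∀ e ∈ (triWalk u k).edgeParity, e ≠ s(c, d) → e ∈ (zdGraph 2).edgeSet := by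
    intro u k c d hc hd h12 h23
    subst hc hd
    have hinj := corner_injective u
    have hne13 : corner u (k + 1) ≠ corner u (k + 3) := fun h => by have := hinj h; omega
    have hne12 : corner u (k + 1) ≠ corner u (k + 2) := h12.ne
    have hne23 : corner u (k + 2) ≠ corner u (k + 3) := h23.ne
    have d1 : s(corner u (k + 3), corner u (k + 1)) ≠ s(corner u (k + 1), corner u (k + 2)) := by
      simp [hne12, hne13.symm, hne23.symm]
    have d2 : s(corner u (k + 3), corner u (k + 1)) ≠ s(corner u (k + 2), corner u (k + 3)) := by
      simp [hne13, hne12, hne23.symm]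
    constructor
    · change s(corner u (k + 3), corner u (k + 1)) ∈ ({s(corner u (k + 1), corner u (k + 2))} : Finset _) ∆
        (({s(corner u (k + 2), corner u (k + 3))} : Finset _) ∆ (({s(corner u (k + 3), corner u (k + 1))} : Finset _) ∆ ∅))
      rw [mem_singleton_symmDiff_of_ne d1, mem_singleton_symmDiff_of_ne d2]
      exact self_mem_singleton_symmDiff (Finset.notMem_empty _)
    · intro e he hne
      have h' := mem_edges_of_mem_edgeParity _ he
      simp only [triWalk, Walk.edges_cons, Walk.edges_nil, List.mem_cons, List.not_mem_nil, or_false] at h'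
      rcases h' with rfl | rfl | rfl
      · simpa using h12
      · simpa using h23
      · exact absurd rfl hne
  -- coordinates of the diagonal
  have h0 := hab.2 0; have h1 := hab.2 1
  rw [abs_le] at h0 h1
  have hne := hab.1
  rw [zdGraph_two_adj_iff] at hnot
  push Not at hnot
  have hcase : (b 0 = a 0 + 1 ∧ b 1 = a 1 + 1) ∨ (b 0 = a 0 + 1 ∧ a 1 = b 1 + 1) ∨
      (a 0 = b 0 + 1 ∧ b 1 = a 1 + 1) ∨ (a 0 = b 0 + 1 ∧ a 1 = b 1 + 1) := by
    have : a ≠ b := hne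
    rw [Ne, Site.eq_iff_two] at this
    omega
  rcases hcase with ⟨e0, e1⟩ | ⟨e0, e1⟩ | ⟨e0, e1⟩ | ⟨e0, e1⟩
  · -- `b = a + ex + ey`: square `a`, omit corner `3`
    refine ⟨a, 3, ?_⟩
    have c1 : corner a (3 + 1) = a := rfl
    have c2 : corner a (3 + 2) = a + ex := rfl
    have c3 : corner a (3 + 3) = b := Site.eq_iff_two.2 ⟨by simp [corner]; omega, by simp [corner]; omega⟩
    have h := key a 3 b a c3 c1 (by rw [c1, c2]; exact (zdGraph_adj_iff _ _).2 ⟨0, Or.inl rfl⟩)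
      (by rw [c2, c3, zdGraph_two_adj_iff]; simp; omega)
    rw [Sym2.eq_swap] at h
    exact h
  · -- `a = u + ey`, `b = u + ex` with `u = a - ey`: omit corner `2`
    refine ⟨a - ey, 2, ?_⟩
    have c1 : corner (a - ey) (2 + 1) = a := Site.eq_iff_two.2 ⟨by simp [corner], by simp [corner]⟩
    have c2 : corner (a - ey) (2 + 2) = a - ey := rfl
    have c3 : corner (a - ey) (2 + 3) = b := Site.eq_iff_two.2 ⟨by simp [corner]; omega, by simp [corner]; omega⟩
    have h := key (a - ey) 2 b a c3 c1 (by rw [c1, c2, zdGraph_two_adj_iff]; simp)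
      (by rw [c2, c3, zdGraph_two_adj_iff]; simp; omega)
    rw [Sym2.eq_swap] at h
    exact h
  · -- `a = u + ex`, `b = u + ey` with `u = a - ex`: omit corner `2`, diagonal `s(a, b)` directly
    refine ⟨a - ex, 2, ?_⟩
    have c1 : corner (a - ex) (2 + 1) = b := Site.eq_iff_two.2 ⟨by simp [corner]; omega, by simp [corner]; omega⟩
    have c2 : corner (a - ex) (2 + 2) = a - ex := rfl
    have c3 : corner (a - ex) (2 + 3) = a := Site.eq_iff_two.2 ⟨by simp [corner], by simp [corner]⟩
    exact key (a - ex) 2 a b c3 c1 (by rw [c1, c2, zdGraph_two_adj_iff]; simp; omega)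
      (by rw [c2, c3, zdGraph_two_adj_iff]; simp)
  · -- `a = b + ex + ey`: square `b`, omit corner `3`
    refine ⟨b, 3, ?_⟩
    have c1 : corner b (3 + 1) = b := rfl
    have c2 : corner b (3 + 2) = b + ex := rfl
    have c3 : corner b (3 + 3) = a := Site.eq_iff_two.2 ⟨by simp [corner]; omega, by simp [corner]; omega⟩
    exact key b 3 a b c3 c1 (by rw [c1, c2]; exact (zdGraph_adj_iff _ _).2 ⟨0, Or.inl rfl⟩)
      (by rw [c2, c3, zdGraph_two_adj_iff]; simp; omega)

/-- The number of diagonal (non-lattice) edges. [folklore] -/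
def numDiag (E : Finset (Sym2 (Site 2))) : ℕ := #(E.filter fun e => e ∉ (zdGraph 2).edgeSet)

/-- Re-indexing the squares inside the basic family. [folklore] -/
theorem xorSum_kingBasic_map_four (S : Finset (Site 2)) :
    xorSum kingBasic (S.map ⟨fun u => (u, (4 : Fin 5)), fun _ _ h => (Prod.mk.inj h).1⟩) = xorSum unitSq S := by
  ext e
  rw [mem_xorSum_iff, mem_xorSum_iff, Finset.filter_map, Finset.card_map]
  congr! 3

/-- **Triangles and squares generate the even edge sets of the `∗`-graph of `ℤ²`** (Timár 2013,
§2, for `ℤ²` with the `∗`-adjacency): every finite even set of `∗`-edges is a mod-2 sum of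
triangles and unit squares. Proof: each diagonal lies in a triangle whose other two edges are
lattice edges; subtracting these triangles removes all diagonals, and the remaining even lattice set
is a sum of squares (`exists_eq_xorSum_unitSq`). [cite: Timar2013, §2] -/
theorem exists_eq_xorSum_kingBasic : ∀ (n : ℕ) (E : Finset (Sym2 (Site 2))), numDiag E ≤ n →
    (∀ e ∈ E, e ∈ zdStarGraph.edgeSet) → IsEulerian E → ∃ T : Finset (Site 2 × Fin 5), E = xorSum kingBasic T := by
  intro n
  induction n with
  | zero =>
    intro E hD hE hEu
    have hlat : ∀ e ∈ E, e ∈ (zdGraph 2).edgeSet := by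
      intro e he
      by_contra h
      have : e ∈ E.filter fun e => e ∉ (zdGraph 2).edgeSet := Finset.mem_filter.2 ⟨he, h⟩
      rw [numDiag, Nat.le_zero, Finset.card_eq_zero] at hD
      rw [hD] at this; simp at this
    obtain ⟨S, hS⟩ := exists_eq_xorSum_unitSq E hlat hEu
    exact ⟨S.map ⟨fun u => (u, (4 : Fin 5)), fun _ _ h => (Prod.mk.inj h).1⟩, by rw [xorSum_kingBasic_map_four, hS]⟩
  | succ n ih =>
    intro E hD hE hEu
    by_cases hD' : numDiag E ≤ n
    · exact ih E hD' hE hEu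
    -- pick a diagonal edge
    obtain ⟨d, hd⟩ : (E.filter fun e => e ∉ (zdGraph 2).edgeSet).Nonempty := by
      rw [Finset.nonempty_iff_ne_empty]; intro h; rw [numDiag, h] at hD'; simp at hD'
    obtain ⟨hdE, hdlat⟩ := Finset.mem_filter.1 hd
    obtain ⟨u, k, hdtri, htri⟩ : ∃ (u : Site 2) (k : Fin 4), d ∈ (triWalk u k).edgeParity ∧
        ∀ e ∈ (triWalk u k).edgeParity, e ≠ d → e ∈ (zdGraph 2).edgeSet := by
      induction d using Sym2.ind with
      | h a b =>
        have hab : zdStarGraph.Adj a b := by have := hE _ hdE; simpa using this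
        exact exists_tri_of_diag hab (fun h => hdlat ((mem_edgeSet _).2 h))
    set p : Site 2 × Fin 5 := (u, ⟨k, by omega⟩) with hp
    have hpk : kingBasic p = (triWalk u k).edgeParity := by
      rw [kingBasic, dif_pos (show ((p.2 : Fin 5) : ℕ) < 4 from k.is_lt)]
    set E' := E ∆ kingBasic p with hE'
    have hE'edge : ∀ e ∈ E', e ∈ zdStarGraph.edgeSet := by
      intro e he
      rcases Finset.mem_symmDiff.1 he with ⟨h, -⟩ | ⟨h, -⟩
      · exact hE e h
      · exact kingBasic_subset_edgeSet p e h
    have hE'eu : IsEulerian E' := hEu.symmDiff (isEulerian_kingBasic p)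
    have hD'' : numDiag E' ≤ n := by
      -- the diagonals of `E'` are those of `E` other than `d`
      have hsub : E'.filter (fun e => e ∉ (zdGraph 2).edgeSet) ⊆ (E.filter fun e => e ∉ (zdGraph 2).edgeSet).erase d := by
        intro e he
        obtain ⟨heE', helat⟩ := Finset.mem_filter.1 he
        rw [Finset.mem_erase, Finset.mem_filter]
        rcases Finset.mem_symmDiff.1 heE' with ⟨h1, h2⟩ | ⟨h1, h2⟩
        · refine ⟨fun hed => h2 ?_, h1, helat⟩
          rw [hed, hpk]; exact hdtri
        · exfalso
          rw [hpk] at h1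
          by_cases hed : e = d
          · exact h2 (hed ▸ hdE)
          · exact helat (htri e h1 hed)
      have := Finset.card_le_card hsub
      rw [Finset.card_erase_of_mem hd] at this
      rw [numDiag] at hD ⊢
      omega
    obtain ⟨T, hT⟩ := ih E' hD'' hE'edge hE'eu
    refine ⟨T ∆ {p}, ?_⟩
    rw [← xorSum_symmDiff, ← hT, show xorSum kingBasic ({p} : Finset (Site 2 × Fin 5)) = kingBasic p by
      ext e; rw [mem_xorSum_iff, Finset.filter_singleton]; split_ifs with h <;> simp [h],
      hE', symmDiff_assoc, symmDiff_self, symmDiff_bot]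

end King

/-! ### The `∗`-boundary of a `∗`-connected set is `∗`-connected -/

section StarBoundary

/-- **Boundary connectivity for `∗`-clusters of `ℤ²`** (Timár 2013, Thm. 3 / Lemma 2 for the
`∗`-graph of `ℤ²`; Kesten 1982, Lemma 2.23): let `C` be a finite `∗`-connected set of sites and
`x, y ∉ C` sites `∗`-adjacent to `C` that are joined by a `∗`-walk avoiding `C`. Then `x` and `y`
are joined by a `∗`-walk all of whose sites lie outside `C` and are `∗`-adjacent to `C`. [cite: Timar2013, Thm. 3] -/
theorem exists_starWalk_starBoundary (C : Finset (Site 2))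
    (hC : ∀ a ∈ C, ∀ b ∈ C, ∃ p : zdStarGraph.Walk a b, ∀ z ∈ p.support, z ∈ C)
    {x y : Site 2} (hx : x ∉ C) (hxC : ∃ c ∈ C, zdStarGraph.Adj x c) (hyC : ∃ c ∈ C, zdStarGraph.Adj y c)
    (P₁ : zdStarGraph.Walk x y) (hP₁ : ∀ v ∈ P₁.support, v ∉ C) :
    ∃ q : zdStarGraph.Walk x y, ∀ v ∈ q.support, v ∉ C ∧ ∃ c ∈ C, zdStarGraph.Adj v c := by
  classical
  by_cases hxy : x = y
  · subst hxy
    exact ⟨Walk.nil, fun v hv => by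
      rw [Walk.support_nil, List.mem_singleton] at hv; subst hv; exact ⟨hx, hxC⟩⟩
  obtain ⟨cx, hcx, hxcx⟩ := hxC
  obtain ⟨cy, hcy, hycy⟩ := hyC
  obtain ⟨pc, hpc⟩ := hC cx hcx cy hcy
  -- `P₂ = x ~ cx ~~ cy ~ y`, every edge touching `C`
  set P₂ : zdStarGraph.Walk x y := Walk.cons hxcx (pc.append (Walk.cons hycy.symm Walk.nil)) with hP₂def
  have hP₂ : ∀ e ∈ P₂.edges, ∃ v ∈ e, v ∈ (↑C : Set (Site 2)) := by
    intro e he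
    rw [hP₂def, Walk.edges_cons, List.mem_cons, Walk.edges_append, List.mem_append, Walk.edges_cons] at he
    rcases he with rfl | he | he
    · exact ⟨cx, Sym2.mem_mk_right _ _, hcx⟩
    · induction e using Sym2.ind with
      | h a b => exact ⟨a, Sym2.mem_mk_left _ _, hpc a (Walk.fst_mem_support_of_mem_edges _ he)⟩
    · simp only [Walk.edges_nil, List.mem_cons, List.not_mem_nil, or_false] at he
      subst he
      exact ⟨cy, Sym2.mem_mk_left _ _, hcy⟩
  -- the even set `P₁ + P₂` is a sum of basic sets
  set E := P₁.edgeParity ∆ P₂.edgeParity with hEdef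
  have hEeu : IsEulerian E := by
    intro v hv
    rw [hEdef, oddDeg_symmDiff_iff, oddDeg_edgeParity_iff, oddDeg_edgeParity_iff] at hv
    tauto
  have hEedge : ∀ e ∈ E, e ∈ zdStarGraph.edgeSet := by
    intro e he
    rcases Finset.mem_symmDiff.1 he with ⟨h, -⟩ | ⟨h, -⟩
    · exact Walk.edges_subset_edgeSet _ (mem_edges_of_mem_edgeParity _ h)
    · exact Walk.edges_subset_edgeSet _ (mem_edges_of_mem_edgeParity _ h)
  obtain ⟨T, hT⟩ := exists_eq_xorSum_kingBasic (numDiag E) E le_rfl hEedge hEeu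
  refine exists_walk_boundary_of_xorSum (C := (↑C : Set (Site 2))) (B := {v | ∃ c ∈ C, zdStarGraph.Adj v c})
    hxy P₁ (fun v hv => by exact_mod_cast hP₁ v hv) P₂ hP₂ kingBasic T (fun p _ => isEulerian_kingBasic p)
    (fun p _ => kingBasic_subset_edgeSet p) hT (fun p _ hmeet e he v hv hvC => ?_) |>.imp fun q hq v hv => ?_
  · -- a basic set meeting `C`: its other vertices are `∗`-adjacent to the meeting corner
    obtain ⟨e', he', w, hw, hwC⟩ := hmeet
    obtain ⟨j, rfl⟩ := corner_of_mem_kingBasic he' hw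
    obtain ⟨j', rfl⟩ := corner_of_mem_kingBasic he hv
    refine ⟨corner p.1 j, hwC, ?_⟩
    rcases corner_adj_or_eq p.1 j' j with h | h
    · exact absurd (h ▸ hwC) hvC
    · exact h
  · exact ⟨(hq v hv).2, (hq v hv).1⟩

end StarBoundary

end Literature.Probability.Percolation
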